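import Literature.NumberTheory.Automorphic.Liu2021.LemD1RankTwoCMLetters
import HarnessLib

/-!
# [Liu2021, App. D, Lemma D.1 (4) «only if» with `μ′ = μ`, `χ′ = χ`, and (1)] read on the RANK-2 CM θ-packages: SAME-LABEL LOCAL LINE RIGIDITY at a
# non-split place — the letter «R₂» of the LD2 organ U₂″ (small sibling of ★ `LemD1RankTwoCMLetters`; statement only)

[Liu2021] = Y. Liu, *Fourier–Jacobi cycles and arithmetic relative trace formula*, Camb. J. Math. **9** (2021) = arXiv:2102.11518, App. D Lemma D.1
(p. 125–126; TeX l. 5227–5262).  Topic `NumberTheory/Automorphic/Liu2021`; namespace `Literature.NumberTheory.Automorphic.Liu2021.LemD1RankTwoCMLetters` (that of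
the two booked rank-2 CM letters ★ `LemD1_4AsPrintedNonsplitCM₂` (L4-full) and ★ `LemD1_1AsPrintedCM₂` (L1), p832219, whose local tokens this file REUSES verbatim).
STATEMENT ONLY: ONE closed named fact `def LemD1_4SameLabelNonsplitCM₂ : Prop` (consumers unfold it by `δ`; an `Iff.rfl` unfolding lemma exceeds the default heartbeats on these tokens and is omitted); no instance, no notation, no `sorry`, no new carrier.
Cell `hodgecm-mathlib`, half A line LD2 (socket `stub_S1b_facts`, books row #74), ruling «U₂″-TRIM» = T2 (LD2-plan (g0) 2026-09-02): this ONE row replaces the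
two rows L4-full + L1 among the letters of the organ U₂″ `SameLabelClasses₂` (★ `Theorems/F0LD2SameLabelClassesOfLetters`), through the ADD-ONLY editions 2 of ★
`Theorems/F0LD2SameLabelLineClass` (`lineClassRigidity₂_of_sameLabel (hR₂)`) and ★ `Theorems/F0LD2SameLabelClassesOfLetters` (`sameLabelClasses₂_of_letters' (hU) (hR₂)`).
MONOTONICITY (print-truth BY INHERITANCE, certified in the tree, not here — its proof needs Summits-side ★ theorems, which a Literature module may not import):
★ `Theorems/F0LD2SameLabelLineClassAtPlace` edition 2, `lemD1_4SameLabelNonsplitCM₂_of_letters (h4 : LemD1_4AsPrintedNonsplitCM₂) (h1 : LemD1_1AsPrintedCM₂) :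
LemD1_4SameLabelNonsplitCM₂` (the E₂ stage-B argument ★ p848707 with a frame-free relabelling unit, [Omeara1963, 71:19]).

THE STATEMENT («R₂»).  For every CM field `L` (`L⁺ = maximalRealSubfield L`, `c` = complex conjugation), real non-zero frame `dV : Fin 2 → L`, reindexing
`e₁ : Fin 2 × Fin 1 ≃ Fin n′`, LABEL `λ` — a conjugate-symplectic idèle class character of `L` of WEIGHT ONE ([Liu2021, Rem. 4.2, Def. 4.3]) —, lines `a, a′ ∈ (L⁺)ˣ`,
central character `χ`, and every finite place `v` of `L⁺` NON-SPLIT in `L` (`c • w = w` for all `w ∣ v`): IF the local θ-type `Θ_v(λ, a′, χ)` (the `χ_v`-quotient of the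
`v`-component of the θ-package `(λ, a′, χ)` restricted to `U(diag dV)(L⁺_v)`, tokens ★ `localType₂` ∕ stage B of ★ p848707) is NON-ZERO and `Θ_v(λ, a, χ) ≅ Θ_v(λ, a′, χ)`
(Mathlib `Representation.Equiv`), THEN the lines `a`, `a′` have the SAME local norm class at `v`: `locF L⁺ (imagUnitSq L) a v = locF L⁺ (imagUnitSq L) a′ v`
(★ `locF`; ⇔ `ε_a ~_v ε_{a′}`, ★ `sameClass_epsLine_iff_locF_apply_eq`).
READING.  [Liu2021, Lem. D.1 (4)] (l. 5235): «`ω(μ, ε, χ) ≅ ω(μ′, ε′, χ′) ≠ 0` if and only if either `(μ′, ε′, χ′) = (μ, ε, χ)`, or `n = 2`, `μ′ = μᶜ·χ̌`, `χ′ = χ`, and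
(`V` isotropic ⇒ `ε′ ~ ε`), (`V` anisotropic ⇒ `ε′ ≁ ε`)», its «ONLY IF» direction read with `μ′ = μ`, `χ′ = χ`: the first alternative gives `ε′ = ε`; the second needs
`μ = μᶜ·χ̌`, i.e. `χ̌_v = μ_v²` (`μ_v·μ_vᶜ = 1`, [Liu2021, Rem. 4.2]), and then at an ANISOTROPIC `v` (there `L_v` is a field: `v` non-split) item (1) (l. 5229: «`ω(μ, ε, χ)` is zero
iff `E` is a field, `V` is anisotropic and `χ̌ = μ²`») makes `Θ_v(λ, a′, χ)` ZERO — excluded by the hypothesis —, while at an ISOTROPIC `v` it gives `ε′ ~ ε` itself.  Two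
printed lines; class **U** (a reading).  Its representation-theoretic content at a non-split place is the rank-one theta dichotomy [HarrisKudlaSweet1996, Thm. 6.1]
(the two hermitian lines give the two members of a local packet of `U(V)(L⁺_v)`), which the tree neither books nor proves elsewhere (searched 2026-09-02:
`rg -i dichotomy Literature/NumberTheory/Automorphic/Liu2021 Literature/RepresentationTheory/HarrisKudlaSweet1996`; the in-house non-isomorphism tools ★
`not_areIsomorphicRep_quotRep_of_character(s)` separate by central characters only, which coincide here).
WHY IT MIGHT FAIL: only through a slip in the local tokens (they are those of ★ p848707's stage B, kernel-matched by the monotonicity theorem and by the E₂ consumer);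
SPLIT places are excluded by the non-split binder (there every class is trivial, ★ `locF_apply_eq_of_split₂`), the ZERO carrier by `Nontrivial`.
HONEST LABEL.  HC_CM is proved only modulo the printed citations until rung 0 closes; this letter ENTERS that list (one row «R₂», replacing L4-full + L1 in U₂″'s cone)
and nothing in the tree proves it unconditionally.

## References
* [Liu2021] Y. Liu, Camb. J. Math. 9 (2021): App. D §D.1 Steps 1–3 (l. 5213–5224), Lem. D.1 (1) (l. 5227–5229), (4) (l. 5235, p. 126) and its proof (l. 5241–5262);
  Rem. 4.2, Def. 4.3 (weight one, conjugate symplectic).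
* [HarrisKudlaSweet1996] M. Harris, S. Kudla, W. J. Sweet, *Theta dichotomy for unitary groups*, J. AMS 9 (1996), Thm. 6.1.
* [Omeara1963] O. T. O'Meara, *Introduction to quadratic forms* (1963), §63B, §71 Thm. 71:19 (the relabelling unit of the monotonicity proof).
-/

noncomputable section

open scoped Matrix Kronecker RestrictedProduct NumberField TensorProduct
open NumberField NumberField.mixedEmbedding IsDedekindDomain Filter
open Literature.NumberTheory Literature.NumberTheory.Automorphic Literature.NumberTheory.Automorphic.UnitaryGroup
open Literature.NumberTheory.GelbartRogawski1991 Literature.NumberTheory.GelbartRogawski1991.UnitaryDualPair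
open Literature.NumberTheory.GelbartRogawski1991.UnitaryDualPair.WeilCoinv
open Literature.NumberTheory.GelbartRogawski1991.UnitaryDualPair.LocalSplitting
open Literature.NumberTheory.GelbartRogawski1991.GRConstruction
open Literature.NumberTheory.Weil1964 Literature.RepresentationTheory
open Literature.RepresentationTheory.HeisenbergGroup
open Literature.NumberTheory.GaloisRepresentations Literature.RepresentationTheory.HarrisKudlaSweet1996
open Literature.NumberTheory.Automorphic.IdeleClassGroup Literature.RepresentationTheory.Liu2021
open Literature.NumberTheory.Automorphic.Liu2021 Literature.NumberTheory.Automorphic.Liu2021.Def411WeilCarriers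
open Literature.NumberTheory.Automorphic.Liu2021.Def411WeilCarriersDoubling

namespace Literature.NumberTheory.Automorphic.Liu2021.LemD1RankTwoCMLetters

/-- **«R₂» — [Liu2021, App. D, Lemma D.1 (4) «only if» with `μ′ = μ`, `χ′ = χ`, + (1)]: SAME-LABEL LOCAL LINE RIGIDITY AT A NON-SPLIT PLACE for the rank-2 CM
θ-packages.**  For `L` CM, a real non-zero frame `dV`, `e₁`, a conjugate-symplectic WEIGHT-ONE label `λ`, lines `a, a′`, a central character `χ` and a finite place `v`
of `L⁺` non-split in `L`: if the local θ-type `Θ_v(λ, a′, χ)` is non-zero (`Nontrivial` of its `χ_v`-coinvariant space) and `Θ_v(λ, a, χ) ≅ Θ_v(λ, a′, χ)`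
(`Representation.Equiv` of the local types, tokens of ★ p848707 stage B verbatim), then `locF L⁺ (imagUnitSq L) a v = locF L⁺ (imagUnitSq L) a′ v`.  A NAMED FACT (not
proved here; implied by the booked ★ `LemD1_4AsPrintedNonsplitCM₂` + ★ `LemD1_1AsPrintedCM₂` — monotonicity theorem in ★ `Theorems/F0LD2SameLabelLineClassAtPlace`
edition 2); content = rank-one theta dichotomy. [cite: Liu2021, App. D Lem. D.1 (4) (p. 126, TeX l. 5235) and (1) (p. 125, l. 5229); Rem. 4.2]
[cite: HarrisKudlaSweet1996, Thm. 6.1] -/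
def LemD1_4SameLabelNonsplitCM₂ : Prop :=
  ∀ (L : Type) [Field L] [NumberField L] [IsCMField L]
      (dV : Fin 2 → L) (hdV : ∀ i, IsCMField.complexConj L (dV i) = dV i) (hdV0 : ∀ i, dV i ≠ 0)
      {n' : ℕ} (e₁ : Fin 2 × Fin 1 ≃ Fin n')
      (lam : Literature.NumberTheory.Automorphic.IdeleClassGroup L →ₜ* Circle) (hlam : IsConjugateSymplectic L lam), HasWeight L lam 1 →
    ∀ (a a' : (↥(maximalRealSubfield L))ˣ) (χ : Chi (↥(maximalRealSubfield L)) L (IsCMField.complexConj L))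
      (v : HeightOneSpectrum (𝓞 (↥(maximalRealSubfield L)))),
      (∀ w : UnitaryGroup.PlacesOver L v, IsCMField.complexConj L • (w : HeightOneSpectrum (𝓞 L)) = w) →
      Nontrivial (TwistedCoinv.Coinv (show Representation ℂ (UnitaryGroup.localPi L (IsCMField.complexConj L) 1 (JW (Fp L) L a') v) (SchwartzBruhat (Fin n' → v.adicCompletion (Fp L))) from (((congrW L e₁ dV hdV (lineW L (TW (Fp L) a')) (complexConj_lineW L (TW (Fp L) a')) (realDiagonal_lineW L (TW (Fp L) a')) (diagonal_lineW L (TW (Fp L) a') (JW_eq (Fp L) L a')) (undoubledSplittings L e₁ dV hdV hdV0 (lineW L (TW (Fp L) a')) (complexConj_lineW L (TW (Fp L) a')) (lineW_ne_zero L (TW (Fp L) a') (isUnit_det_TW (Fp L) a')) (toHeckeCharacter L lam) (borelPlaceMeasure L) (cmFinLocalFamily L e₁ dV hdV hdV0 (lineW L (TW (Fp L) a')) (complexConj_lineW L (TW (Fp L) a')) (lineW_ne_zero L (TW (Fp L) a') (isUnit_det_TW (Fp L) a')) (toHeckeCharacter L lam) ((isOscillatorChar_toHeckeCharacter_iff lam).mpr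 hlam) (borelPlaceMeasure L))) (isSymm_TW (Fp L) a') (JW_eq (Fp L) L a'))).omegaLoc v).comp (localCenter L (IsCMField.complexConj L) n' (Matrix.reindex e₁ e₁ (Matrix.diagonal dV ⊗ₖ JW (Fp L) L a')) (JW (Fp L) L a') (JW_apply_ne_zero (Fp L) L a') v)) (localCharOfCenter (Fp L) L (IsCMField.complexConj L) (JW (Fp L) L a') (JW_apply_ne_zero (Fp L) L a') χ.1 v)) →
      Nonempty ((show Representation ℂ (localPi L (IsCMField.complexConj L) 2 (Matrix.diagonal dV) v) _ from (TwistedCoinv.rep (localCharOfCenter (Fp L) L (IsCMField.complexConj L) (JW (Fp L) L a) (JW_apply_ne_zero (Fp L) L a) χ.1 v) (((congrW L e₁ dV hdV (lineW L (TW (Fp L) a)) (complexConj_lineW L (TW (Fp L) a)) (realDiagonal_lineW L (TW (Fp L) a)) (diagonal_lineW L (TW (Fp L) a) (JW_eq (Fp L) L a)) (undoubledSplittings L e₁ dV hdV hdV0 (lineW L (TW (Fp L) a)) (complexConj_lineW L (TW (Fp L) a)) (lineW_ne_zero L (TW (Fp L) a) (isUnit_det_TW (Fp L) a)) (toHeckeCharacter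 L lam) (borelPlaceMeasure L) (cmFinLocalFamily L e₁ dV hdV hdV0 (lineW L (TW (Fp L) a)) (complexConj_lineW L (TW (Fp L) a)) (lineW_ne_zero L (TW (Fp L) a) (isUnit_det_TW (Fp L) a)) (toHeckeCharacter L lam) ((isOscillatorChar_toHeckeCharacter_iff lam).mpr hlam) (borelPlaceMeasure L))) (isSymm_TW (Fp L) a) (JW_eq (Fp L) L a))).omegaLoc v) (commute_omegaLoc_localCenter (Fp L) L (IsCMField.complexConj L) 2 e₁ (Matrix.diagonal dV) (JW (Fp L) L a) (complexConj_imagUnit L) (imagUnit_ne_zero L) (imagUnit_mul_self L) (realDiagonal_isSymm L dV hdV) (isSymm_TW (Fp L) a) (realDiagonal_map L dV hdV).symm (JW_eq (Fp L) L a) (JW_apply_ne_zero (Fp L) L a) (congrW L e₁ dV hdV (lineW L (TW (Fp L) a)) (complexConj_lineW L (TW (Fp L) a)) (realDiagonal_lineW L (TW (Fp L) a)) (diagonal_lineW L (TW (Fp L) a) (JW_eq (Fp L) L a)) (undoubledSplittings L e₁ dV hdV hdV0 (lineW L (TW (Fp L) a)) (complexConj_lineW L (TW (Fp L) a)) (lineW_ne_zero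 L (TW (Fp L) a) (isUnit_det_TW (Fp L) a)) (toHeckeCharacter L lam) (borelPlaceMeasure L) (cmFinLocalFamily L e₁ dV hdV hdV0 (lineW L (TW (Fp L) a)) (complexConj_lineW L (TW (Fp L) a)) (lineW_ne_zero L (TW (Fp L) a) (isUnit_det_TW (Fp L) a)) (toHeckeCharacter L lam) ((isOscillatorChar_toHeckeCharacter_iff lam).mpr hlam) (borelPlaceMeasure L))) (isSymm_TW (Fp L) a) (JW_eq (Fp L) L a)) v)).comp (localLineInl L (IsCMField.complexConj L) 2 e₁ (Matrix.diagonal dV) (JW (Fp L) L a) v)).Equiv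
        (show Representation ℂ (localPi L (IsCMField.complexConj L) 2 (Matrix.diagonal dV) v) _ from (TwistedCoinv.rep (localCharOfCenter (Fp L) L (IsCMField.complexConj L) (JW (Fp L) L a') (JW_apply_ne_zero (Fp L) L a') χ.1 v) (((congrW L e₁ dV hdV (lineW L (TW (Fp L) a')) (complexConj_lineW L (TW (Fp L) a')) (realDiagonal_lineW L (TW (Fp L) a')) (diagonal_lineW L (TW (Fp L) a') (JW_eq (Fp L) L a')) (undoubledSplittings L e₁ dV hdV hdV0 (lineW L (TW (Fp L) a')) (complexConj_lineW L (TW (Fp L) a')) (lineW_ne_zero L (TW (Fp L) a') (isUnit_det_TW (Fp L) a')) (toHeckeCharacter L lam) (borelPlaceMeasure L) (cmFinLocalFamily L e₁ dV hdV hdV0 (lineW L (TW (Fp L) a')) (complexConj_lineW L (TW (Fp L) a')) (lineW_ne_zero L (TW (Fp L) a') (isUnit_det_TW (Fp L) a')) (toHeckeCharacter L lam) ((isOscillatorChar_toHeckeCharacter_iff lam).mpr hlam) (borelPlaceMeasure L))) (isSymm_TW (Fp L) a') (JW_eq (Fp L) L a'))).omegaLoc v) (commute_omegaLoc_localCenter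 (Fp L) L (IsCMField.complexConj L) 2 e₁ (Matrix.diagonal dV) (JW (Fp L) L a') (complexConj_imagUnit L) (imagUnit_ne_zero L) (imagUnit_mul_self L) (realDiagonal_isSymm L dV hdV) (isSymm_TW (Fp L) a') (realDiagonal_map L dV hdV).symm (JW_eq (Fp L) L a') (JW_apply_ne_zero (Fp L) L a') (congrW L e₁ dV hdV (lineW L (TW (Fp L) a')) (complexConj_lineW L (TW (Fp L) a')) (realDiagonal_lineW L (TW (Fp L) a')) (diagonal_lineW L (TW (Fp L) a') (JW_eq (Fp L) L a')) (undoubledSplittings L e₁ dV hdV hdV0 (lineW L (TW (Fp L) a')) (complexConj_lineW L (TW (Fp L) a')) (lineW_ne_zero L (TW (Fp L) a') (isUnit_det_TW (Fp L) a')) (toHeckeCharacter L lam) (borelPlaceMeasure L) (cmFinLocalFamily L e₁ dV hdV hdV0 (lineW L (TW (Fp L) a')) (complexConj_lineW L (TW (Fp L) a')) (lineW_ne_zero L (TW (Fp L) a') (isUnit_det_TW (Fp L) a')) (toHeckeCharacter L lam) ((isOscillatorChar_toHeckeCharacter_iff lam).mpr hlam) (borelPlaceMeasure L))) (isSymm_TW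 (Fp L) a') (JW_eq (Fp L) L a')) v)).comp (localLineInl L (IsCMField.complexConj L) 2 e₁ (Matrix.diagonal dV) (JW (Fp L) L a') v))) →
      locF (↥(maximalRealSubfield L)) (imagUnitSq L) a v = locF (↥(maximalRealSubfield L)) (imagUnitSq L) a' v

end Literature.NumberTheory.Automorphic.Liu2021.LemD1RankTwoCMLetters

end
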